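import Summits.CriticalPhenomena.SAWScalingLimit.Theses.SAWTipEnvironment
import Summits.CriticalPhenomena.SAWScalingLimit.Theorems.SubseqIdentification.Negative.CoincidentEndpointLaw
import Literature.Probability.RandomPlanarGeometry.LocalMartingaleProofs
import Literature.Probability.RandomPlanarGeometry.SLEExistenceNeEightHolds

/-!
# Crux `KappaPin` (stmt-CriticalPhenomena-16040): necessity, load-bearing hypotheses, non-vacuity

Refuter by-products of the crux-attack cycle (2026-08-17) on
`Summit.CriticalPhenomena.SAWScalingLimit.Theses.SAWTipEnvironment.KappaPin` (route
SAWTipEnvironment): "for every Dobrushin domain and endpoint approximation, a probability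
subsequential limit law `ν` of the critical SAW curve laws that is a chordal SLE_κ law of `(D; a, b)`
for some `κ > 0` has `κ = 8/3`". None of the theorems below asserts the crux; they record what a
prover gets for free, which hypothesis any proof must use, and why the crux cannot be refuted
without refuting the summit conjunct.

* `kappaPin_of_sawScalingLimit` — **S → C modulo κ-injectivity of the SLE law at `8/3`.** If the
  critical SAW curve laws converge in law to chordal SLE_{8/3} (`SAWScalingLimit`), every
  subsequential limit law `ν` IS the SLE_{8/3} law of `(D; a, b)` (uniqueness of weak limits of finite
  measures on the metric space `CurveClass ℂ`, `ext_of_forall_integral_eq_of_IsFiniteMeasure`; the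
  pre-Wiener measure is a probability measure unconditionally, `isProbabilityMeasure_preWienerMeasure'`),
  so `IsSLELaw κ D ν` forces `κ = 8/3` as soon as one SLE law cannot carry two values of `κ`.
  Consequence (`not_sawScalingLimit_or_of_not_kappaPin`): an unconditional `¬ KappaPin` proves
  `¬ SAWScalingLimit ∨ ¬ κ-injectivity`, i.e. kills the Lawler–Schramm–Werner conjecture as typed or a
  theorem of SLE theory — the crux is an honest necessary condition with no slack to exploit.
* `kappaPin_false_without_isSubseqLimitLaw` — **the hypothesis `IsSubseqLimitLaw` is load-bearing**:
  with it dropped the statement is FALSE, witnessed by the chordal SLE₆ law of the unit disc (exists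
  unconditionally in the tree, `exists_isSLELaw_of_ne_eight`) and the honest endpoint approximation
  `isEndpointApprox_std` of `(𝔻; 1, -1)`; no κ-injectivity is needed for this (`6 ≠ 8/3` as numbers).
* `kappaPin_iff_dropProbability` — the hypothesis `IsProbabilityMeasure ν` is decoration: it follows
  from `IsSLELaw κ D ν` (`isProbabilityMeasure_of_isSLELaw`).
* `kappaPin_of_forall_not_isSLELaw` — the C ↛ S direction of the restates-summit probe: the crux is
  also implied by the scenario "no subsequential limit of the critical SAW is a chordal SLE law",
  which is silent about `SAWScalingLimit`; so `KappaPin` does not restate the conjunct.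
* `hypotheses_satisfiable_of_sawScalingLimit` — non-vacuity in the intended world: under
  `SAWScalingLimit` the full hypothesis bundle of the crux is inhabited (unit disc, standard
  endpoints, `ν` = the SLE_{8/3} law, `κ = 8/3`). Unconditionally no Dobrushin domain is known to
  carry a subsequential limit of the critical `ℤ²` SAW (tightness along one sequence is open), so the
  crux cannot at present be tested on an instance — which is also why no cheap refutation exists.
-/

noncomputable section

open Literature.Probability.RandomPlanarGeometry Literature.Probability.RandomPlanarGeometry.SAW
  Literature.Probability.LatticeModels Literature.Probability MeasureTheory Filter Topology Set
open scoped NNReal ENNReal BoundedContinuousFunction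

namespace Summit.CriticalPhenomena.SAWScalingLimit.Theorems.KappaPin.Negative

open Summit.CriticalPhenomena.SAWScalingLimit.Theses.SAWTipEnvironment
open Summit.CriticalPhenomena.SAWScalingLimit.Theorems.SubseqIdentification.Negative
  (isEndpointApprox_std)

/-- An SLE law is a probability measure, unconditionally (push-forward of the pre-Wiener measure,
a probability measure by `isProbabilityMeasure_preWienerMeasure'`). [folklore] -/
theorem isProbabilityMeasure_of_isSLELaw {κ : ℝ≥0} {D : DobrushinDomain}
    {ν : Measure (CurveClass ℂ)} (h : IsSLELaw κ D ν) : IsProbabilityMeasure ν := by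
  obtain ⟨Γ, hΓ, rfl⟩ := h
  haveI := isProbabilityMeasure_preWienerMeasure'
  exact Measure.isProbabilityMeasure_map hΓ.aemeasurable

/-- **The crux is NECESSARY for the conjunct, modulo κ-injectivity of `IsSLELaw` at `8/3`.**
`(∀ κ D ν, 0 < κ → IsSLELaw κ D ν → IsSLELaw (8/3) D ν → κ = 8/3) → SAWScalingLimit → KappaPin`:
under convergence in law to SLE_{8/3}, a subsequential limit law along `s n → 0⁺` equals the
SLE_{8/3} law (weak limits of finite measures on `CurveClass ℂ` are unique), and the injectivity
hypothesis pins `κ`. [folklore] -/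
theorem kappaPin_of_sawScalingLimit
    (hinj : ∀ (κ : ℝ≥0) (D : DobrushinDomain) (ν : Measure (CurveClass ℂ)), 0 < κ →
      IsSLELaw κ D ν → IsSLELaw ((8 : ℝ≥0) / 3) D ν → κ = 8 / 3)
    (h : _root_.SAWScalingLimit) : KappaPin := by
  intro D a b hab ν hν hsub κ hκ hSLE
  obtain ⟨Γ, hΓ, -, hT⟩ := h D a b hab
  obtain ⟨s, hs, hlim⟩ := hsub
  haveI := isProbabilityMeasure_preWienerMeasure'
  haveI : IsProbabilityMeasure (Process.preWienerMeasure.map Γ) :=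
    Measure.isProbabilityMeasure_map hΓ.aemeasurable
  have key : ν = Process.preWienerMeasure.map Γ := by
    apply ext_of_forall_integral_eq_of_IsFiniteMeasure
    intro f
    rw [integral_map hΓ.aemeasurable f.continuous.aestronglyMeasurable]
    exact tendsto_nhds_unique (hlim f) ((hT f).comp hs)
  exact hinj κ D ν hκ hSLE (key ▸ hΓ.isSLELaw_map)

/-- Contrapositive, for the record: an unconditional refutation of the crux refutes the summit
conjunct or κ-injectivity of the SLE law at `8/3`. [folklore] -/
theorem not_sawScalingLimit_or_of_not_kappaPin (h : ¬ KappaPin) :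
    ¬ _root_.SAWScalingLimit ∨
      ¬ ∀ (κ : ℝ≥0) (D : DobrushinDomain) (ν : Measure (CurveClass ℂ)), 0 < κ →
        IsSLELaw κ D ν → IsSLELaw ((8 : ℝ≥0) / 3) D ν → κ = 8 / 3 := by
  by_cases hS : _root_.SAWScalingLimit
  · exact Or.inr fun hinj => h (kappaPin_of_sawScalingLimit hinj hS)
  · exact Or.inl hS

/-- **`IsSubseqLimitLaw` is load-bearing**: the crux with that hypothesis dropped is FALSE. Witness:
the unit disc `(𝔻; 1, -1)` with its standard endpoint approximation and `ν` the chordal SLE₆ law of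
the disc (`exists_isSLELaw_of_ne_eight`, unconditional in the tree); `6 ≠ 8/3`. So any proof of
`KappaPin` must use that `ν` is a subsequential limit of the critical SAW laws. [folklore] -/
theorem kappaPin_false_without_isSubseqLimitLaw :
    ¬ ∀ (D : DobrushinDomain) (a b : ℝ → Site 2), IsEndpointApprox D a b →
        ∀ ν : Measure (CurveClass ℂ), IsProbabilityMeasure ν →
          ∀ κ : ℝ≥0, 0 < κ → IsSLELaw κ D ν → κ = 8 / 3 := by
  intro h
  obtain ⟨ν, hν⟩ := exists_isSLELaw_of_ne_eight (κ := 6) (by norm_num) (by norm_num)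
    DobrushinDomain.unitDisc
  have h6 : (6 : ℝ≥0) = 8 / 3 :=
    h DobrushinDomain.unitDisc _ _ isEndpointApprox_std ν (isProbabilityMeasure_of_isSLELaw hν) 6
      (by norm_num) hν
  have h6' := congrArg (fun x : ℝ≥0 => (x : ℝ)) h6
  push_cast at h6'
  norm_num at h6'

/-- **The hypothesis `IsProbabilityMeasure ν` of the crux is decoration**: the crux is equivalent
to the same statement with that hypothesis dropped. [folklore] -/
theorem kappaPin_iff_dropProbability :
    KappaPin ↔ ∀ (D : DobrushinDomain) (a b : ℝ → Site 2), IsEndpointApprox D a b →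
      ∀ ν : Measure (CurveClass ℂ),
        IsSubseqLimitLaw (fun δ (γ : DomainSAW D.carrier δ (a δ) (b δ)) => γ.curve)
          (fun δ => law D.carrier δ (a δ) (b δ)) ν →
        ∀ κ : ℝ≥0, 0 < κ → IsSLELaw κ D ν → κ = 8 / 3 := by
  constructor
  · intro h D a b hab ν hsub κ hκ hSLE
    exact h D a b hab ν (isProbabilityMeasure_of_isSLELaw hSLE) hsub κ hκ hSLE
  · intro h D a b hab ν _ hsub κ hκ hSLE
    exact h D a b hab ν hsub κ hκ hSLE

/-- **C ↛ S (restates-summit probe, negative direction).** The crux also follows from the scenario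
"no probability subsequential limit of the critical SAW curve laws is a chordal SLE_κ law, for any
`κ > 0`", which says nothing about convergence to SLE_{8/3}; hence `KappaPin` is not a restatement
of `SAWScalingLimit`. [folklore] -/
theorem kappaPin_of_forall_not_isSLELaw
    (h0 : ∀ (D : DobrushinDomain) (a b : ℝ → Site 2), IsEndpointApprox D a b →
      ∀ ν : Measure (CurveClass ℂ), IsProbabilityMeasure ν →
        IsSubseqLimitLaw (fun δ (γ : DomainSAW D.carrier δ (a δ) (b δ)) => γ.curve)
          (fun δ => law D.carrier δ (a δ) (b δ)) ν →
        ∀ κ : ℝ≥0, 0 < κ → ¬ IsSLELaw κ D ν) : KappaPin := by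
  intro D a b hab ν hν hsub κ hκ hSLE
  exact absurd hSLE (h0 D a b hab ν hν hsub κ hκ)

/-- **Non-vacuity in the intended world.** Under the summit conjunct the hypothesis bundle of the
crux is inhabited: the unit disc with its standard endpoint approximation, `ν` the SLE_{8/3} law
(the limit law given by `SAWScalingLimit`, a subsequential limit along `s n = 1/(n+1)` by
`TendstoLaw.isSubseqLimitLaw`) and `κ = 8/3`. [folklore] -/
theorem hypotheses_satisfiable_of_sawScalingLimit (h : _root_.SAWScalingLimit) :
    ∃ (D : DobrushinDomain) (a b : ℝ → Site 2) (ν : Measure (CurveClass ℂ)) (κ : ℝ≥0),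
      IsEndpointApprox D a b ∧ IsProbabilityMeasure ν ∧
        IsSubseqLimitLaw (fun δ (γ : DomainSAW D.carrier δ (a δ) (b δ)) => γ.curve)
          (fun δ => law D.carrier δ (a δ) (b δ)) ν ∧ 0 < κ ∧ IsSLELaw κ D ν := by
  obtain ⟨Γ, hΓ, -, hT⟩ := h DobrushinDomain.unitDisc _ _ isEndpointApprox_std
  haveI := isProbabilityMeasure_preWienerMeasure'
  exact ⟨DobrushinDomain.unitDisc, _, _, Process.preWienerMeasure.map Γ, 8 / 3, isEndpointApprox_std,
    Measure.isProbabilityMeasure_map hΓ.aemeasurable, hT.isSubseqLimitLaw hΓ.aemeasurable,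
    by positivity, hΓ.isSLELaw_map⟩

/-- The bare conclusion `κ = 8/3` is false for general `κ > 0` (e.g. `κ = 1`): the crux is not
closed by arithmetic (`simp`, `aesop`, `exact?`, `norm_num`, `decide` all fail on it). [folklore] -/
theorem conclusion_alone_false : ¬ ∀ κ : ℝ≥0, 0 < κ → κ = 8 / 3 := by
  intro h
  have h1 := congrArg (fun x : ℝ≥0 => (x : ℝ)) (h 1 one_pos)
  push_cast at h1
  norm_num at h1

end Summit.CriticalPhenomena.SAWScalingLimit.Theorems.KappaPin.Negative
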